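import Literature.NumberTheory.EllipticCurves.LangHeightNonarchEstimate
import Literature.NumberTheory.EllipticCurves.NaiveHeightLocalDecomposition
import Literature.NumberTheory.DiophantineGeometry.ConductorFactorizationProofs
import Literature.NumberTheory.DiophantineGeometry.MinimalDiscriminantFactorizationProofs
import Literature.NumberTheory.DiophantineGeometry.MinimalDiscriminantFiniteProofs
import Literature.NumberTheory.DiophantineGeometry.MinimalDiscriminantProofs
import Literature.NumberTheory.DiophantineGeometry.ConductorRadicalProofs
import Literature.NumberTheory.DiophantineGeometry.ConductorMultiplicativeProofs
import Literature.NumberTheory.DiophantineGeometry.LocalReductionProofs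
import Literature.NumberTheory.EllipticCurves.NeronComponentDataAssembly
import Mathlib.Algebra.Order.BigOperators.Ring.Finset
import HarnessLib

/-!
# Petsche's non-archimedean estimate from Lemma 3, the Kodaira–Néron/Ogg bound and Jensen

Sibling proof file of `LangHeightNonarchEstimate.lean` (topic `NumberTheory/EllipticCurves`,
family `abc`, G06). It proves `Petsche2006_le_finsum_localHeightDiscSum_of`: the non-archimedean
estimate of Petsche's proof of Proposition 7 over `ℚ`
(`Literature.NumberTheory.EllipticCurves.Petsche2006_le_finsum_localHeightDiscSum`, file
`LangHeightSmallPoints.lean`),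

  `Σ_{v fin} Λ_v(Z) ≥ (1/12) (1/(16σ²) − 1/N) log N(𝔇)`,

from Petsche's Lemma 3 at every finite place (`Petsche2006_lemma3`), the tree's Kodaira–Néron facts
(`WeierstrassCurve.index_goodReductionSubgroup_le_four`,
`WeierstrassCurve.index_goodReductionSubgroup_of_hasSplitMultiplicativeReduction`, file
`KodairaNeron.lean`, at the local minimal models — packaged here as `kodairaNeron_tamagawaNumberAt_of`,
from which Petsche's bound (30) `(η_v c_v)² ≤ 16 δ_v²`, `c_v ≥ 1` is derived,
`conductorExponent_mul_tamagawaNumberAt_sq_le_of`) and the finiteness part of the local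
decomposition of `ĥ` (ATAEC VI.2.1,
`WeierstrassCurve.Affine.Point.canonicalHeight_eq_two_mul_sum_neronLocalHeight`, only used to know
that `v ↦ Λ_v(Z)` is finitely supported, so that the `finsum` is a sum). The Jensen/Ogg assembly
itself is `Petsche2006_le_finsum_localHeightDiscSum_of_localBound`, whose reduction-theoretic input
is exactly `1 ≤ c_v ∧ (η_v c_v)² ≤ 16 δ_v²` at every finite place, so that it can be fed with the
Kodaira–Néron theorem in whichever form the tree proves it.

## Proof (Petsche 2006, proof of Prop. 7, pp. 264–265, `d = 1`)

Let `T = {v | δ_v ≠ 0}` be the bad places (`δ_v = ord_v Δ_min`, finite by AEC VIII.1 Rem. 1.3,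
`MinimalDiscriminantFiniteProofs`). Then

* `Σᶠ_v Λ_v ≥ Σ_{v ∈ T} Λ_v`, because `Λ_v ≥ 0` off `T` (Lemma 3 with `δ_v = 0`);
* `Σ_T Λ_v ≥ (1/12) Σ_T (1/c_v² − 1/N) δ_v log p_v = (1/12)(Σ_T δ_v log p_v / c_v² − log N(𝔇)/N)`
  (Lemma 3; `log N(𝔇) = Σ_T δ_v log p_v` from `WeierstrassCurve.factorization_minimalDiscriminantNorm`);
* Jensen's inequality, in the equivalent Sedrakyan (Cauchy–Schwarz) form
  `(Σ_T η_v log p_v)² / Σ_T 16 δ_v log p_v ≤ Σ_T (η_v log p_v)²/(16 δ_v log p_v) ≤ Σ_T δ_v log p_v / c_v²`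
  (termwise `η_v² c_v² ≤ 16 δ_v²`), i.e. `Σ_T δ_v log p_v / c_v² ≥ (log N_E)²/(16 log N(𝔇))`
  (`log N_E = Σ_T η_v log p_v` from `WeierstrassCurve.factorization_conductorNorm` and Ogg's
  `η_v ≤ δ_v`), which is `log N(𝔇)/(16 σ²)` when `N_E > 1` (`σ = log N(𝔇)/log N_E`);
* if `N_E = 1` then `N(𝔇) = 1` (`radical N_E = radical N(𝔇)`, `ConductorRadicalProofs`), `T = ∅`,
  `σ = 1` and the claim reads `0 ≤ Σᶠ_v Λ_v`, true termwise.

## Design notes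

* Pure proofs (`--kind proof`); `log_natCast_eq_sum_natGenerator` (file
  `NaiveHeightLocalDecomposition.lean`) turns `Nat.factorization` statements indexed by
  `Rat.HeightOneSpectrum.natGenerator` into `Real.log` identities.

## References

* C. Petsche, *Small rational points on elliptic curves over number fields*, New York J. Math. 12
  (2006), 257–268; arXiv math/0508160: Lemma 3, proof of Prop. 7 (displays (27)–(30) of the arXiv
  version).
* J. H. Silverman, *Advanced Topics in the Arithmetic of Elliptic Curves*, GTM 151 (1994), IV.9,
  IV.11.1, VI.2.1; *The Arithmetic of Elliptic Curves*, 2nd ed. (2009), VIII.8, C.16.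
-/

noncomputable section

open scoped Classical

open IsDedekindDomain

namespace Literature.NumberTheory.EllipticCurves

-- `NeronComponentDataAssembly` declares `Literature.NumberTheory.EllipticCurves.WeierstrassCurve`,
-- so the Mathlib namespace must be opened with `_root_` here (CONVENTIONS §2).
open _root_.WeierstrassCurve _root_.WeierstrassCurve.Affine.Point Petsche2006 Rat.HeightOneSpectrum

/-! ### Logarithms of `N(𝔣)` and `N(𝔇)` as sums over the places of `ℤ` -/

section Rat

variable (W : WeierstrassCurve ℚ) [W.IsElliptic]

omit [W.IsElliptic] in
/-- `log N(𝔇_min) = Σ_{v : ord_v Δ_min ≠ 0} ord_v(Δ_min) · log p_v` over `ℚ`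
(from `WeierstrassCurve.factorization_minimalDiscriminantNorm`, AEC VIII.8). [folklore] -/
theorem log_minimalDiscriminantNorm_eq_sum {T : Finset (HeightOneSpectrum ℤ)}
    (hT : ∀ v, W.ordMinimalDiscriminant v ≠ 0 → v ∈ T) :
    Real.log (W.minimalDiscriminantNorm ℤ : ℝ) =
      ∑ v ∈ T, (W.ordMinimalDiscriminant v : ℝ) * Real.log (natGenerator v) :=
  log_natCast_eq_sum_natGenerator (minimalDiscriminantNorm_pos_holds W).ne'
    (fun v => factorization_minimalDiscriminantNorm_holds W v) hT

/-- `log N_E = Σ_{v : ord_v Δ_min ≠ 0} f_v · log p_v` over `ℚ` (from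
`WeierstrassCurve.factorization_conductorNorm`, AEC C.16, and `f_v ≤ ord_v Δ_min`, Ogg). [folklore] -/
theorem log_conductorNorm_eq_sum {T : Finset (HeightOneSpectrum ℤ)}
    (hT : ∀ v, W.ordMinimalDiscriminant v ≠ 0 → v ∈ T) :
    Real.log (W.conductorNorm ℤ : ℝ) =
      ∑ v ∈ T, (W.conductorExponent v : ℝ) * Real.log (natGenerator v) :=
  log_natCast_eq_sum_natGenerator (conductorNorm_pos_holds W).ne'
    (fun v => factorization_conductorNorm_holds W v) fun v hv =>
      hT v fun h => hv (Nat.eq_zero_of_le_zero (h ▸ conductorExponent_le_ordMinimalDiscriminant v W))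

end Rat

/-! ### Kodaira–Néron at the places of `ℚ` and Petsche's local bound (30) -/

/-- **The Kodaira–Néron theorem at a finite place of `ℚ`** (Silverman, AEC Thm. VII.6.1; ATAEC
Cor. IV.9.2(d)), packaged for `c_v = W.tamagawaNumberAt v`: `1 ≤ c_v`, `c_v = ord_v(Δ_min)` for split
multiplicative reduction, and `c_v ≤ 4` otherwise — from the tree's named facts
`WeierstrassCurve.index_goodReductionSubgroup_le_four` and
`WeierstrassCurve.index_goodReductionSubgroup_of_hasSplitMultiplicativeReduction` (file
`KodairaNeron.lean`) at `(O_v, W.localMinimalModel v)` (hypotheses `h4`, `hsplit`), the proved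
finiteness for finite residue fields
(`WeierstrassCurve.index_goodReductionSubgroup_ne_zero_of_finite_residueField`,
`TamagawaNeZeroProofs.lean`; the residue field of `O_v` is finite over `ℚ`, `Conductor.lean`) and the
proved bridge `localTamagawaNumber_eq_ordMinimalDiscriminant_of_kodairaNeron`
(`NeronComponentDataAssembly.lean`). [cite: SilvermanAEC2009, Thm VII.6.1] -/
theorem kodairaNeron_tamagawaNumberAt_of
    (h4 : ∀ (W : WeierstrassCurve ℚ) (v : HeightOneSpectrum ℤ),
      (W.localMinimalModel v).index_goodReductionSubgroup_le_four (v.adicCompletionIntegers ℚ))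
    (hsplit : ∀ (W : WeierstrassCurve ℚ) (v : HeightOneSpectrum ℤ),
      (W.localMinimalModel v).index_goodReductionSubgroup_of_hasSplitMultiplicativeReduction
        (v.adicCompletionIntegers ℚ))
    (W : WeierstrassCurve ℚ) [W.IsElliptic] (v : HeightOneSpectrum ℤ) :
    1 ≤ W.tamagawaNumberAt v ∧
      (W.HasSplitMultiplicativeReductionAt v → W.tamagawaNumberAt v = W.ordMinimalDiscriminant v) ∧
      (¬ W.HasSplitMultiplicativeReductionAt v → W.tamagawaNumberAt v ≤ 4) := by
  haveI : PerfectField (IsLocalRing.ResidueField (v.adicCompletionIntegers ℚ)) :=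
    PerfectField.ofFinite
  haveI := W.isElliptic_localMinimalModel v
  refine ⟨Nat.one_le_iff_ne_zero.mpr
      ((W.localMinimalModel v).index_goodReductionSubgroup_ne_zero_of_finite_residueField _),
    fun hs => localTamagawaNumber_eq_ordMinimalDiscriminant_of_kodairaNeron (hsplit W v) hs,
    fun hns => ((h4 W v) hns).2⟩

/-- **Petsche 2006, proof of Prop. 7, display (30) and the parenthetical following it** (p. 264),
over `ℚ` and at every finite place: `1 ≤ c_v` and `(η_v c_v)² ≤ 16 δ_v²`. *"(To see this, recall
that if `E/k_v` has split multiplicative reduction then `δ_v = c_v` and `η_v = 1`, and (30) holds;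
while otherwise `η_v ≤ δ_v` and `c_v ≤ 4`, and (30) follows in this case as well.)"* — from the
Kodaira–Néron theorem (`kodairaNeron_tamagawaNumberAt_of`, AEC VII.6.1), `f_v = 1` for
multiplicative reduction (`WeierstrassCurve.conductorExponent_eq_one_iff`, ATAEC IV.10.2(b),
discharged in `ConductorMultiplicativeProofs`) and Ogg's formula `f_v ≤ ord_v Δ_min`
(`WeierstrassCurve.conductorExponent_le_ordMinimalDiscriminant`). At a place of good reduction
`η_v = δ_v = 0`, so the inequality is trivial there. [cite: Petsche2006, proof of Prop. 7, (30)] -/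
theorem conductorExponent_mul_tamagawaNumberAt_sq_le_of
    (h4 : ∀ (W : WeierstrassCurve ℚ) (v : HeightOneSpectrum ℤ),
      (W.localMinimalModel v).index_goodReductionSubgroup_le_four (v.adicCompletionIntegers ℚ))
    (hsplit : ∀ (W : WeierstrassCurve ℚ) (v : HeightOneSpectrum ℤ),
      (W.localMinimalModel v).index_goodReductionSubgroup_of_hasSplitMultiplicativeReduction
        (v.adicCompletionIntegers ℚ))
    (W : WeierstrassCurve ℚ) [W.IsElliptic] (v : HeightOneSpectrum ℤ) :
    1 ≤ W.tamagawaNumberAt v ∧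
      (W.conductorExponent v * W.tamagawaNumberAt v) ^ 2 ≤ 16 * W.ordMinimalDiscriminant v ^ 2 := by
  obtain ⟨h1, hs, hother⟩ := kodairaNeron_tamagawaNumberAt_of h4 hsplit W v
  refine ⟨h1, ?_⟩
  have hOgg := conductorExponent_le_ordMinimalDiscriminant v W
  by_cases hsp : W.HasSplitMultiplicativeReductionAt v
  · have hη : W.conductorExponent v = 1 :=
      (conductorExponent_eq_one_iff_holds v W).mpr hsp.hasMultiplicativeReductionAt
    rw [hs hsp, hη, one_mul]
    nlinarith
  · have hc := hother hsp
    calc (W.conductorExponent v * W.tamagawaNumberAt v) ^ 2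
        ≤ (W.conductorExponent v * 4) ^ 2 := by gcongr
      _ = 16 * W.conductorExponent v ^ 2 := by ring
      _ ≤ 16 * W.ordMinimalDiscriminant v ^ 2 := by gcongr

/-! ### The non-archimedean estimate -/

/-- **Petsche's non-archimedean estimate from Lemma 3 and the local bound (30)** (Petsche 2006,
proof of Prop. 7, pp. 264–265, over `ℚ`): the Jensen/Ogg assembly of
`Petsche2006_le_finsum_localHeightDiscSum` with its two reduction-theoretic inputs isolated as
hypotheses — Lemma 3 at every finite place (`h3`) and, at every finite place, `1 ≤ c_v` together
with Petsche's display (30), `(η_v c_v)² ≤ 16 δ_v²` (`h30`; a consequence of the Kodaira–Néron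
theorem, see `conductorExponent_mul_tamagawaNumberAt_sq_le_of`) — plus the finiteness part of the
local decomposition ATAEC VI.2.1 (`hd`, used only to know that `v ↦ Λ_v(Z)` is finitely supported).
Printed argument: `Σ_v Λ_v(Z) ≥ Σ_{v bad} Λ_v(Z)` (Lemma 3 gives `Λ_v ≥ 0` at good `v`),
`≥ (1/12) Σ_bad (1/c_v² − 1/N) δ_v log p_v` (Lemma 3, `log|1/Δ_v|_v = δ_v log p_v`), and by
Jensen's inequality — here in the equivalent Sedrakyan/Cauchy–Schwarz form
`(Σ η_v log p_v)² ≤ (Σ 16 δ_v log p_v)(Σ δ_v log p_v / c_v²)` via `η_v² ≤ 16δ_v²/c_v²` —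
`Σ_bad δ_v log p_v / c_v² ≥ (log N𝔣)²/(16 log N𝔇) = log N𝔇/(16σ²)`, using
`log N𝔣 = Σ η_v log p_v`, `log N𝔇 = Σ δ_v log p_v`; if `E` has everywhere good reduction
(`N_E = 1`, so `N(𝔇) = 1` by `radical N_E = radical N(𝔇)`), both sides are compared with `0`.
[cite: Petsche2006, proof of Prop. 7] -/
theorem Petsche2006_le_finsum_localHeightDiscSum_of_localBound (h3 : Petsche2006_lemma3)
    (h30 : ∀ (W : WeierstrassCurve ℚ) [W.IsElliptic] (v : HeightOneSpectrum ℤ),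
      1 ≤ W.tamagawaNumberAt v ∧
        (W.conductorExponent v * W.tamagawaNumberAt v) ^ 2 ≤ 16 * W.ordMinimalDiscriminant v ^ 2)
    (hd : ∀ W : WeierstrassCurve ℚ, canonicalHeight_eq_two_mul_sum_neronLocalHeight W) :
    Petsche2006_le_finsum_localHeightDiscSum := by
  intro W _ Z hZ
  replace h30 := h30 W
  -- notation
  set N : ℝ := (Z.card : ℝ) with hN
  have hNpos : 0 < N := by rw [hN]; exact_mod_cast hZ.card_pos
  set δ : HeightOneSpectrum ℤ → ℝ := fun v => (W.ordMinimalDiscriminant v : ℝ) with hδ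
  set η : HeightOneSpectrum ℤ → ℝ := fun v => (W.conductorExponent v : ℝ) with hη
  set c : HeightOneSpectrum ℤ → ℝ := fun v => (W.tamagawaNumberAt v : ℝ) with hc
  set ℓ : HeightOneSpectrum ℤ → ℝ := fun v => Real.log (natGenerator v) with hℓ
  set Λ : HeightOneSpectrum ℤ → ℝ := fun v => localHeightDiscSum (padicAbv v) Z with hΛ
  have hℓpos : ∀ v, 0 < ℓ v := fun v => Real.log_pos (by exact_mod_cast (prime_natGenerator v).one_lt)
  have hc1 : ∀ v, 1 ≤ c v := fun v => by
    show (1 : ℝ) ≤ (W.tamagawaNumberAt v : ℝ)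
    exact_mod_cast (h30 v).1
  have h30' : ∀ v, (η v * c v) ^ 2 ≤ 16 * δ v ^ 2 := fun v => by
    show ((W.conductorExponent v : ℝ) * (W.tamagawaNumberAt v : ℝ)) ^ 2 ≤
      16 * (W.ordMinimalDiscriminant v : ℝ) ^ 2
    exact_mod_cast (h30 v).2
  have hηδ : ∀ v, η v ≤ δ v := fun v => by
    show (W.conductorExponent v : ℝ) ≤ (W.ordMinimalDiscriminant v : ℝ)
    exact_mod_cast conductorExponent_le_ordMinimalDiscriminant v W
  -- Lemma 3 at every place
  have hL3 : ∀ v, (1 / c v ^ 2 - 1 / N) * (1 / 12 * (δ v * ℓ v)) ≤ Λ v := fun v => h3 W v Z hZ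
  -- the bad places
  set T : Finset (HeightOneSpectrum ℤ) :=
    (finite_setOf_ordMinimalDiscriminant_ne_zero_holds W).toFinset with hT
  have hmemT : ∀ v, v ∈ T ↔ W.ordMinimalDiscriminant v ≠ 0 := fun v => by
    rw [hT, Set.Finite.mem_toFinset, Set.mem_setOf_eq]
  have hT' : ∀ v, W.ordMinimalDiscriminant v ≠ 0 → v ∈ T := fun v hv => (hmemT v).mpr hv
  have hδpos : ∀ v ∈ T, 0 < δ v := fun v hv => by
    have := (hmemT v).mp hv
    show (0 : ℝ) < (W.ordMinimalDiscriminant v : ℝ)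
    exact_mod_cast Nat.pos_of_ne_zero this
  have hδ0 : ∀ v ∉ T, δ v = 0 := fun v hv => by
    have := (hmemT v).not.mp hv
    push Not at this
    simp [hδ, this]
  -- `log N(𝔇) = Σ_T δ ℓ`, `log N(𝔣) = Σ_T η ℓ`
  have hLD : Real.log (W.minimalDiscriminantNorm ℤ : ℝ) = ∑ v ∈ T, δ v * ℓ v :=
    log_minimalDiscriminantNorm_eq_sum W hT'
  have hLF : Real.log (W.conductorNorm ℤ : ℝ) = ∑ v ∈ T, η v * ℓ v :=
    log_conductorNorm_eq_sum W hT'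
  set L := Real.log (W.minimalDiscriminantNorm ℤ : ℝ) with hLdef
  -- `Λ` is finitely supported (from the local decomposition) and `≥ 0` off `T`
  have hΛ0 : ∀ v ∉ T, 0 ≤ Λ v := fun v hv => by
    have := hL3 v
    rw [hδ0 v hv, zero_mul, mul_zero, mul_zero] at this
    exact this
  have hne : ∀ P ∈ Z, ∀ Q ∈ Z.erase P, P - Q ≠ 0 := fun P hP Q hQ =>
    sub_ne_zero.mpr (Finset.ne_of_mem_erase hQ).symm
  obtain ⟨U, hU⟩ : ∃ U : Finset (HeightOneSpectrum ℤ), Function.support Λ ⊆ U := by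
    have hfin : (⋃ x ∈ (Z.sigma fun P => Z.erase P : Finset _),
        Function.support fun v : HeightOneSpectrum ℤ =>
          (x.1 - x.2).neronLocalHeight (padicAbv v)).Finite := by
      refine Set.Finite.biUnion (Finset.finite_toSet _) fun x hx => ?_
      rw [Finset.mem_coe, Finset.mem_sigma] at hx
      exact ((hd W) (x.1 - x.2) (hne x.1 hx.1 x.2 hx.2)).1
    refine ⟨hfin.toFinset, fun v hv => ?_⟩
    rw [Set.Finite.coe_toFinset, Set.mem_iUnion₂]
    by_contra hcon
    push Not at hcon
    apply hv
    rw [hΛ]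
    simp only [localHeightDiscSum]
    rw [Finset.sum_sigma' Z fun P => Z.erase P, Finset.sum_eq_zero fun x hx => ?_, mul_zero]
    have := hcon x hx
    rwa [Function.mem_support, not_not] at this
  have hfinsum : ∑ᶠ v, Λ v = ∑ v ∈ T ∪ U, Λ v :=
    finsum_eq_sum_of_support_subset Λ (hU.trans (by simp))
  have hstep1 : ∑ v ∈ T, Λ v ≤ ∑ᶠ v, Λ v := by
    rw [hfinsum]
    exact Finset.sum_le_sum_of_subset_of_nonneg Finset.subset_union_left
      fun v _ hv => hΛ0 v hv
  -- Lemma 3 summed over `T`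
  have hstep2 : 1 / 12 * (∑ v ∈ T, δ v * ℓ v / c v ^ 2 - L / N) ≤ ∑ v ∈ T, Λ v := by
    calc 1 / 12 * (∑ v ∈ T, δ v * ℓ v / c v ^ 2 - L / N)
        = ∑ v ∈ T, (1 / c v ^ 2 - 1 / N) * (1 / 12 * (δ v * ℓ v)) := by
          rw [hLD, Finset.sum_div, ← Finset.sum_sub_distrib, Finset.mul_sum]
          exact Finset.sum_congr rfl fun v _ => by ring
      _ ≤ ∑ v ∈ T, Λ v := Finset.sum_le_sum fun v _ => hL3 v
  -- Jensen / Sedrakyan: `(Σ_T η ℓ)² ≤ 16 L · Σ_T δ ℓ / c²`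
  have hstep3 : (∑ v ∈ T, η v * ℓ v) ^ 2 ≤ (16 * L) * ∑ v ∈ T, δ v * ℓ v / c v ^ 2 := by
    by_cases hTne : T = ∅
    · simp [hTne]
    have hg : ∀ v ∈ T, 0 < 16 * (δ v * ℓ v) := fun v hv =>
      mul_pos (by norm_num) (mul_pos (hδpos v hv) (hℓpos v))
    have hsum : 0 < ∑ v ∈ T, 16 * (δ v * ℓ v) :=
      Finset.sum_pos hg (Finset.nonempty_iff_ne_empty.mpr hTne)
    have hT16 : ∑ v ∈ T, 16 * (δ v * ℓ v) = 16 * L := by rw [hLD, Finset.mul_sum]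
    have hSed := Finset.sq_sum_div_le_sum_sq_div T (fun v => η v * ℓ v) hg
    rw [hT16, div_le_iff₀ (by rwa [← hT16])] at hSed
    refine hSed.trans ?_
    rw [Finset.sum_mul]
    -- termwise: `(η ℓ)²/(16 δ ℓ) · 16L ≤ 16 L · δ ℓ / c²` ⟸ `η² c² ≤ 16 δ²`
    rw [Finset.mul_sum]
    refine Finset.sum_le_sum fun v hv => ?_
    have hδv := hδpos v hv
    have hℓv := hℓpos v
    have hcv : 0 < c v := one_pos.trans_le (hc1 v)
    have hL0 : 0 ≤ L := by
      rw [hLdef]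
      exact Real.log_nonneg (by exact_mod_cast minimalDiscriminantNorm_pos_holds W)
    have key : (η v * ℓ v) ^ 2 / (16 * (δ v * ℓ v)) ≤ δ v * ℓ v / c v ^ 2 := by
      rw [div_le_div_iff₀ (hg v hv) (by positivity)]
      calc (η v * ℓ v) ^ 2 * c v ^ 2 = ℓ v ^ 2 * (η v * c v) ^ 2 := by ring
        _ ≤ ℓ v ^ 2 * (16 * δ v ^ 2) := by gcongr; exact h30' v
        _ = δ v * ℓ v * (16 * (δ v * ℓ v)) := by ring
    rw [mul_comm (16 * L)]
    exact mul_le_mul_of_nonneg_right key (by positivity)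
  -- assemble
  by_cases h1 : 1 < W.conductorNorm ℤ
  · rw [szpiroRatio_of_one_lt_conductorNorm _ _ h1]
    set A := Real.log (W.conductorNorm ℤ : ℝ) with hAdef
    have hApos : 0 < A := Real.log_pos (by exact_mod_cast h1)
    have hAL : A ≤ L := by
      rw [hLF, hLD]
      exact Finset.sum_le_sum fun v _ => mul_le_mul_of_nonneg_right (hηδ v) (hℓpos v).le
    have hLpos : 0 < L := hApos.trans_le hAL
    have hkey : A ^ 2 / (16 * L) ≤ ∑ v ∈ T, δ v * ℓ v / c v ^ 2 := by
      rw [div_le_iff₀ (by positivity), hLF]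
      linarith [hstep3]
    calc 1 / 12 * (1 / (16 * (L / A) ^ 2) - 1 / N) * L
        = 1 / 12 * (A ^ 2 / (16 * L) - L / N) := by
          field_simp
      _ ≤ 1 / 12 * (∑ v ∈ T, δ v * ℓ v / c v ^ 2 - L / N) := by gcongr
      _ ≤ ∑ v ∈ T, Λ v := hstep2
      _ ≤ ∑ᶠ v, Λ v := hstep1
  · push Not at h1
    rw [szpiroRatio_of_conductorNorm_le_one _ _ h1]
    -- `N_E = 1`, hence `N(𝔇) = 1` and `L = 0`
    have hN1 : W.conductorNorm ℤ = 1 := le_antisymm h1 (conductorNorm_pos_holds W)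
    have hD1 : W.minimalDiscriminantNorm ℤ = 1 := by
      have hrad := radical_conductorNorm_eq_holds W
      rw [hN1, UniqueFactorizationMonoid.radical_one] at hrad  -- radical 1 = 1?
      have := (Nat.radical_eq_one_iff.mp hrad.symm)
      exact le_antisymm this (minimalDiscriminantNorm_pos_holds W)
    have hL0 : L = 0 := by rw [hLdef, hD1]; simp
    rw [hL0, mul_zero]
    have hT0 : ∀ v, v ∉ T := fun v hv => by
      have h := (hmemT v).mp hv
      have hf := factorization_minimalDiscriminantNorm_holds W v
      rw [hD1, Nat.factorization_one, Finsupp.coe_zero, Pi.zero_apply] at hf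
      exact h hf.symm
    rw [hfinsum]
    exact Finset.sum_nonneg fun v _ => hΛ0 v (hT0 v)

/-- **Discharge layer for `Petsche2006_le_finsum_localHeightDiscSum`** (Petsche 2006, proof of
Prop. 7, pp. 264–265, over `ℚ`): from Lemma 3 at every finite place (`Petsche2006_lemma3`), the
Kodaira–Néron/Ogg bound `(η_v c_v)² ≤ 16 δ_v²`, `c_v ≥ 1`
(`conductorExponent_mul_tamagawaNumberAt_sq_le_of`, from the tree's Kodaira–Néron facts `h4`, `hsplit`)
and the finiteness part of the local decomposition ATAEC VI.2.1
(`canonicalHeight_eq_two_mul_sum_neronLocalHeight`); the assembly itself is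
`Petsche2006_le_finsum_localHeightDiscSum_of_localBound`. [cite: Petsche2006, proof of Prop. 7] -/
theorem Petsche2006_le_finsum_localHeightDiscSum_of (h3 : Petsche2006_lemma3)
    (h4 : ∀ (W : WeierstrassCurve ℚ) (v : HeightOneSpectrum ℤ),
      (W.localMinimalModel v).index_goodReductionSubgroup_le_four (v.adicCompletionIntegers ℚ))
    (hsplit : ∀ (W : WeierstrassCurve ℚ) (v : HeightOneSpectrum ℤ),
      (W.localMinimalModel v).index_goodReductionSubgroup_of_hasSplitMultiplicativeReduction
        (v.adicCompletionIntegers ℚ))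
    (hd : ∀ W : WeierstrassCurve ℚ, canonicalHeight_eq_two_mul_sum_neronLocalHeight W) :
    Petsche2006_le_finsum_localHeightDiscSum :=
  Petsche2006_le_finsum_localHeightDiscSum_of_localBound h3
    (fun W _ v => conductorExponent_mul_tamagawaNumberAt_sq_le_of h4 hsplit W v) hd

end Literature.NumberTheory.EllipticCurves

end
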